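import Mathlib

/-!
# DAG node N12 [B15] — (P4)′ road, step (T1): RANK-WISE (block-triangular) SURJECTIVITY — a linear map into a product `ι → E` is onto as soon as, rank by rank,
# the rank-`n` components can be prescribed by vectors whose images VANISH on all LOWER ranks (nothing is asked on higher ranks)

Cell `pub-ymgap` (HUMAN RULINGS D-0062 ∕ D-0149), width seat `pub-ymgap-dag-n12-w6` g6 = the N12 (P4) clone by row (director-ym R463-ym; chair START-LIST 2026-08-28
l.41887; repaired target `hsurj` per dag-n08-c's p657858 §4).  Key K1⁹ `stmt-QuantumFields-27364`, `--kind proof --supports … --as helper`; count-neutral; THEOREMS ONLY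
(0 `def`, 0 `sorry`).  Design note `HOME/pub-ymgap-dag-n12-w6/P4-DESIGN.md`.

WHY.  The surjectivity of the linearised multi-scale constraint `DΨ_{U₀}(0)` at the CURVED guarded minimiser (the (P4)′ target) is organised TRIANGULARLY: the constrained rows of
`𝐁_k(Z)` are ranked (level `0` first, then for `j = 1, …, k` one cluster per inner `j`-site), and for each rank a family of directions is exhibited whose effect on every row of
LOWER rank vanishes EXACTLY (two-block locality of (0.4), a support fact true at every `U₀`) and which is ONTO its own rank (a LOCAL statement: one axial gauge on one `3^d`-block box,
the flat block explicit, a Neumann series on that block).  This file is the abstract back-substitution that turns the rank-wise statement into global surjectivity — no smallness is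
ever asked of the couplings to HIGHER ranks, which is why no global gauge ∕ no global Neumann series (hence no simply-connectedness of `Ω₁(Z)`) enters the (P4)′ road.

CONTENTS.  ★ `exists_preimage_of_rankwise` (targets vanishing below rank `n` are attained, by downward induction on `n`), ★★ `surjective_of_rankwise`, `surjective_of_rankwise'`
(the same with the rank-`n` solvability asked only for targets supported in rank `n`), `surjective_of_rankwise_fintype`; QUANTITATIVE EDITION (the (P4)′ socket of record asks ONE
letter `B` per instance, dag-n12-c g20 ruling 2026-08-28): ★★ `exists_preimage_bound_of_rankwise`, ★★★ `exists_rightInverse_bound_of_rankwise` — from `‖L x‖ ≤ Λ‖x‖` and rank-wise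
solutions of norm `≤ β‖v‖`, a right-inverse function with letter `β·N·(1 + Λβ)^N`.

HONEST FRAMING.  Elementary linear algebra (finite back-substitution), [folklore]; nothing of Bałaban's asserted; N12 NOT discharged; K1⁹ NOT closed; count-neutral (typed 28∕28 ·
discharged 5∕27 unmoved); R4 closes only the conditional finite-𝕋⁴ rung `BalabanLadder.UV`; the YM mass gap (Clay) is NOT proved by any of this.
-/

namespace Summit.QuantumFields.YangMills.BalabanUVNodes.N12DirectSurjTriangular

variable {R : Type*} [Ring R] {X : Type*} [AddCommGroup X] [Module R X] {ι : Type*} {E : Type*} [AddCommGroup E] [Module R E]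

/-- ★ **BACK-SUBSTITUTION, DOWNWARD IN THE RANK.**  Let `L : X → (ι → E)` be linear and `rank : ι → ℕ` bounded by `N`.  Suppose that for every rank `n` and every target `v`, some `x`
realises `v` on the rank-`n` components with `L x` vanishing on all components of rank `< n` (its values on ranks `> n` are free).  Then every target vanishing on the ranks `< n` is in
the range of `L` — in particular (`n = 0`) every target. [folklore] -/
theorem exists_preimage_of_rankwise (L : X →ₗ[R] (ι → E)) (rank : ι → ℕ) {N : ℕ} (hN : ∀ i, rank i < N)
    (h : ∀ n, ∀ v : ι → E, ∃ x : X, (∀ i, rank i = n → L x i = v i) ∧ (∀ i, rank i < n → L x i = 0)) :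
    ∀ (m n : ℕ), N = n + m → ∀ v : ι → E, (∀ i, rank i < n → v i = 0) → ∃ x : X, L x = v := by
  intro m
  induction m with
  | zero =>
    intro n hn v hv
    refine ⟨0, funext fun i => ?_⟩
    rw [map_zero, Pi.zero_apply, hv i (by rw [← Nat.add_zero n, ← hn]; exact hN i)]
  | succ m ih =>
    intro n hn v hv
    obtain ⟨x₁, hx₁, hx₁'⟩ := h n v
    -- the residual target vanishes on the ranks `≤ n`
    have hres : ∀ i, rank i < n + 1 → (v - L x₁) i = 0 := fun i hi => by
      rw [Pi.sub_apply]
      rcases Nat.lt_succ_iff_lt_or_eq.1 hi with hlt | heq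
      · rw [hv i hlt, hx₁' i hlt, sub_zero]
      · rw [hx₁ i heq, sub_self]
    obtain ⟨x₂, hx₂⟩ := ih (n + 1) (by rw [hn]; ring) (v - L x₁) hres
    refine ⟨x₁ + x₂, ?_⟩
    rw [map_add, hx₂, add_sub_cancel]

/-- ★★ **RANK-WISE (BLOCK-TRIANGULAR) SURJECTIVITY.**  A linear `L : X → (ι → E)` with a bounded rank function on the index set is ONTO as soon as, for every rank `n` and every target
`v`, some `x` has `(L x)_i = v_i` on the rank-`n` indices and `(L x)_i = 0` on the indices of rank `< n`.  (The couplings to the ranks `> n` are unconstrained — this is what makes the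
criterion LOCAL in the (P4)′ application.) [folklore] -/
theorem surjective_of_rankwise (L : X →ₗ[R] (ι → E)) (rank : ι → ℕ) {N : ℕ} (hN : ∀ i, rank i < N)
    (h : ∀ n, ∀ v : ι → E, ∃ x : X, (∀ i, rank i = n → L x i = v i) ∧ (∀ i, rank i < n → L x i = 0)) :
    Function.Surjective L := fun v =>
  exists_preimage_of_rankwise L rank hN h N 0 (by rw [Nat.zero_add]) v fun _ hi => (Nat.not_lt_zero _ hi).elim

/-- The same criterion with the rank-`n` solvability asked only for targets SUPPORTED in rank `n` (the shape the per-cluster blocks deliver: «onto the cluster's rows, zero below»).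
[folklore] -/
theorem surjective_of_rankwise' (L : X →ₗ[R] (ι → E)) (rank : ι → ℕ) {N : ℕ} (hN : ∀ i, rank i < N)
    (h : ∀ n, ∀ v : ι → E, (∀ i, rank i ≠ n → v i = 0) → ∃ x : X, (∀ i, rank i = n → L x i = v i) ∧ (∀ i, rank i < n → L x i = 0)) :
    Function.Surjective L := by
  refine surjective_of_rankwise L rank hN fun n v => ?_
  obtain ⟨x, hx, hx'⟩ := h n (fun i => if rank i = n then v i else 0) fun i hi => if_neg hi
  exact ⟨x, fun i hi => by rw [hx i hi, if_pos hi], hx'⟩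

/-- **Finite index sets**: the rank bound is automatic. [folklore] -/
theorem surjective_of_rankwise_fintype [Fintype ι] (L : X →ₗ[R] (ι → E)) (rank : ι → ℕ)
    (h : ∀ n, ∀ v : ι → E, (∀ i, rank i ≠ n → v i = 0) → ∃ x : X, (∀ i, rank i = n → L x i = v i) ∧ (∀ i, rank i < n → L x i = 0)) :
    Function.Surjective L := by
  classical
  refine surjective_of_rankwise' L rank (N := (Finset.univ.sup rank) + 1) (fun i => Nat.lt_succ_of_le (Finset.le_sup (Finset.mem_univ i))) h

/-! ## Quantitative edition: a right inverse WITH A LETTER from rank-wise solvability with a letter -/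

section Normed

variable {X' : Type*} [NormedAddCommGroup X'] [NormedSpace ℝ X'] {ι' : Type*} [Fintype ι'] {E' : Type*} [NormedAddCommGroup E'] [NormedSpace ℝ E']

/-- ★★ **BACK-SUBSTITUTION WITH A LETTER.**  If `‖L x‖ ≤ Λ‖x‖`, and for every rank `n` and target `v` the rank-`n` solution `x` (exact on rank `n`, zero below) can be chosen with
`‖x‖ ≤ β‖v‖`, then every target vanishing on the ranks `< n`, `N = n + m`, has a preimage with `‖x‖ ≤ β·m·(1 + Λβ)^m·‖v‖` (the residual after one step has norm `≤ (1 + Λβ)‖v‖`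
in the sup norm of `ι → E`). [folklore] -/
theorem exists_preimage_bound_of_rankwise (L : X' →ₗ[ℝ] (ι' → E')) (rank : ι' → ℕ) {N : ℕ} (hN : ∀ i, rank i < N) {β Λ : ℝ} (hβ : 0 ≤ β) (hΛ : 0 ≤ Λ)
    (hL : ∀ x, ‖L x‖ ≤ Λ * ‖x‖)
    (h : ∀ n, ∀ v : ι' → E', ∃ x : X', (∀ i, rank i = n → L x i = v i) ∧ (∀ i, rank i < n → L x i = 0) ∧ ‖x‖ ≤ β * ‖v‖) :
    ∀ (m n : ℕ), N = n + m → ∀ v : ι' → E', (∀ i, rank i < n → v i = 0) →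
      ∃ x : X', L x = v ∧ ‖x‖ ≤ β * m * (1 + Λ * β) ^ m * ‖v‖ := by
  intro m
  induction m with
  | zero =>
    intro n hn v hv
    have hv0 : v = 0 := funext fun i => hv i (by rw [← Nat.add_zero n, ← hn]; exact hN i)
    refine ⟨0, ?_, ?_⟩
    · rw [map_zero, hv0]
    · rw [norm_zero, hv0, norm_zero]; positivity
  | succ m ih =>
    intro n hn v hv
    obtain ⟨x₁, hx₁, hx₁', hx₁n⟩ := h n v
    have hres : ∀ i, rank i < n + 1 → (v - L x₁) i = 0 := fun i hi => by
      rw [Pi.sub_apply]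
      rcases Nat.lt_succ_iff_lt_or_eq.1 hi with hlt | heq
      · rw [hv i hlt, hx₁' i hlt, sub_zero]
      · rw [hx₁ i heq, sub_self]
    obtain ⟨x₂, hx₂, hx₂n⟩ := ih (n + 1) (by rw [hn]; ring) (v - L x₁) hres
    refine ⟨x₁ + x₂, by rw [map_add, hx₂, add_sub_cancel], ?_⟩
    have hq : 0 ≤ 1 + Λ * β := by positivity
    have hresn : ‖v - L x₁‖ ≤ (1 + Λ * β) * ‖v‖ := by
      calc ‖v - L x₁‖ ≤ ‖v‖ + ‖L x₁‖ := norm_sub_le _ _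
        _ ≤ ‖v‖ + Λ * (β * ‖v‖) := by gcongr; exact (hL x₁).trans (mul_le_mul_of_nonneg_left hx₁n hΛ)
        _ = (1 + Λ * β) * ‖v‖ := by ring
    have hpow : (1 : ℝ) ≤ (1 + Λ * β) ^ (m + 1) := one_le_pow₀ (by nlinarith)
    calc ‖x₁ + x₂‖ ≤ ‖x₁‖ + ‖x₂‖ := norm_add_le _ _
      _ ≤ β * ‖v‖ + β * m * (1 + Λ * β) ^ m * ((1 + Λ * β) * ‖v‖) :=
          add_le_add hx₁n (hx₂n.trans (mul_le_mul_of_nonneg_left hresn (by positivity)))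
      _ = (β * ‖v‖) * 1 + β * m * (1 + Λ * β) ^ (m + 1) * ‖v‖ := by ring
      _ ≤ (β * ‖v‖) * (1 + Λ * β) ^ (m + 1) + β * m * (1 + Λ * β) ^ (m + 1) * ‖v‖ := by gcongr
      _ = β * ((m + 1 : ℕ) : ℝ) * (1 + Λ * β) ^ (m + 1) * ‖v‖ := by push_cast; ring

/-- ★★★ **RANK-WISE SOLVABILITY WITH A LETTER ⟹ A RIGHT INVERSE WITH A LETTER** (the quantitative form of `surjective_of_rankwise'`, the shape of the (P4)′ socket of record:
«`∃ H, (∀ v, L (H v) = v) ∧ (∀ v, ‖H v‖ ≤ B‖v‖)` with ONE `B` chosen before the target»): from `‖L x‖ ≤ Λ‖x‖` and rank-wise solutions of norm `≤ β‖v‖` for targets supported in one rank,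
a right-inverse FUNCTION `H` with `‖H v‖ ≤ β·N·(1 + Λβ)^N·‖v‖`, `N` any strict bound of the rank. [folklore] -/
theorem exists_rightInverse_bound_of_rankwise (L : X' →ₗ[ℝ] (ι' → E')) (rank : ι' → ℕ) {N : ℕ} (hN : ∀ i, rank i < N) {β Λ : ℝ} (hβ : 0 ≤ β) (hΛ : 0 ≤ Λ)
    (hL : ∀ x, ‖L x‖ ≤ Λ * ‖x‖)
    (h : ∀ n, ∀ v : ι' → E', (∀ i, rank i ≠ n → v i = 0) →
      ∃ x : X', (∀ i, rank i = n → L x i = v i) ∧ (∀ i, rank i < n → L x i = 0) ∧ ‖x‖ ≤ β * ‖v‖) :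
    ∃ H : (ι' → E') → X', (∀ v, L (H v) = v) ∧ ∀ v, ‖H v‖ ≤ β * N * (1 + Λ * β) ^ N * ‖v‖ := by
  classical
  -- rank-wise solvability for arbitrary targets, through the truncated target (whose sup norm is not larger)
  have h' : ∀ n, ∀ v : ι' → E', ∃ x : X', (∀ i, rank i = n → L x i = v i) ∧ (∀ i, rank i < n → L x i = 0) ∧ ‖x‖ ≤ β * ‖v‖ := by
    intro n v
    obtain ⟨x, hx, hx', hxn⟩ := h n (fun i => if rank i = n then v i else 0) fun i hi => if_neg hi
    refine ⟨x, fun i hi => by rw [hx i hi, if_pos hi], hx', hxn.trans (mul_le_mul_of_nonneg_left ?_ hβ)⟩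
    refine (pi_norm_le_iff_of_nonneg (norm_nonneg v)).2 fun i => ?_
    by_cases hi : rank i = n
    · rw [if_pos hi]; exact norm_le_pi_norm v i
    · rw [if_neg hi, norm_zero]; exact norm_nonneg v
  have key := exists_preimage_bound_of_rankwise L rank hN hβ hΛ hL h' N 0 (by rw [Nat.zero_add])
  refine ⟨fun v => Classical.choose (key v fun _ hi => (Nat.not_lt_zero _ hi).elim), fun v => ?_, fun v => ?_⟩
  · exact (Classical.choose_spec (key v fun _ hi => (Nat.not_lt_zero _ hi).elim)).1
  · exact (Classical.choose_spec (key v fun _ hi => (Nat.not_lt_zero _ hi).elim)).2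

end Normed

end Summit.QuantumFields.YangMills.BalabanUVNodes.N12DirectSurjTriangular
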